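import Literature.AlgebraicGeometry.Resolution.TeissierPresentation
import Mathlib.Algebra.MvPolynomial.Expand
import Mathlib.Algebra.Ring.GeomSum
import Mathlib.Tactic.FinCases
import Mathlib.Tactic.Linarith
import Mathlib.Tactic.Positivity
import Mathlib.Tactic.Ring
import HarnessLib

/-!
# `TeissierReduction` (crux stmt-ResolutionOfSingularities-17085, route `TeissierJung`), line
# `Sketch`, stub `stub_bicyclicOverblown`: the over-blown bicyclic fibre product is
# Teissier-presented

Barrier note BN1 (positive half) of the crux-ideate round.  Over `Λ = k⟦x₁, x₂⟧` the
NON-normalised fibre product `Λ[u₀, u₁] ⧸ (u₀² − x₁, u₁² − x₁ⁿ x₂)` (`n ≥ 2`) carries a Teissier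
presentation (`TeissierPresentation` of
`Literature/AlgebraicGeometry/Resolution/TeissierPresentation`) in the loose form of the
predicate: `g = 2`, `n₀ = n₁ = 2`, `c = 1`, `A₀ = (1, 0)`, `A₁ = (n, 1)`, `μ = 0`, tails
`h₀ = u₁` (which erases the link `E₀ = u₁ − core₀`, so that `E₀ = −(u₀² − x₁)`) and `h₁ = 0`,
weights `v₀ = (1/2, 0)`, `v₁ = (n/2, 1/2)` (`2 v₀ = (1, 0) < v₁` uses `n ≥ 2`).

The only real work is the primality, in every characteristic, of the binomial ideal
`J = (U₀² − x₁, U₁² − x₁ⁿ x₂)` of `k[x₁, x₂, U₀, U₁]`: `J` is the kernel of the `k`-algebra map to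
the domain `k[w, s]`, `x₁ ↦ s⁴, x₂ ↦ w², U₀ ↦ s², U₁ ↦ s²ⁿ w` (`isPrime_span_bicyclic`).  Indeed
every polynomial is congruent mod `J` to a normal form `r₀(x₂, U₀) + r₁(x₂, U₀) U₁`
(`exists_normalForm_bicyclic`), whose image is `expand 2 r₀ + expand 2 (r₁ U₀ⁿ) · w`; the two
summands live on monomials of even, resp. odd, `w`-degree, so both vanish, and
`MvPolynomial.expand 2` is injective (`eq_zero_of_expand_two_add`).
-/

-- single-problem summit: the doubled namespace component is forced
set_option linter.dupNamespace false

noncomputable section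

open Literature.AlgebraicGeometry.Resolution

namespace Summit.ResolutionOfSingularities.ResolutionOfSingularities.Theorems.TeissierReduction

open MvPolynomial

/-! ## Primality of the binomial ideal `(U₀² − x₁, U₁² − x₁ⁿ x₂)` -/

/-- Parity separation in `k[w, s]` (`w = X 0`): if `expand 2 p + (expand 2 q) · w = 0` then
`p = q = 0` — the first summand lives on monomials of even `w`-degree, the second on odd ones,
and `expand 2` is injective. [folklore] -/
theorem eq_zero_of_expand_two_add {k : Type*} [Field k] {p q : MvPolynomial (Fin 2) k}
    (H : expand 2 p + expand 2 q * X 0 = 0) : p = 0 ∧ q = 0 := by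
  classical
  have hp : expand 2 p = 0 := by
    ext d
    rw [coeff_zero]
    by_cases hd : 2 ∣ d 0
    · have hcoef := congr_arg (coeff d) H
      rw [coeff_add, coeff_zero, coeff_mul_X'] at hcoef
      split_ifs at hcoef with hmem
      · have hodd : ¬ 2 ∣ (d - Finsupp.single 0 1 : Fin 2 →₀ ℕ) 0 := by
          rw [Finsupp.mem_support_iff] at hmem
          rw [Finsupp.tsub_apply, Finsupp.single_eq_same]
          omega
        rwa [coeff_expand_of_not_dvd q hodd, add_zero] at hcoef
      · rwa [add_zero] at hcoef
    · exact coeff_expand_of_not_dvd p hd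
  have hp' : p = 0 := (expand_eq_zero zero_lt_two).1 hp
  rw [hp, zero_add] at H
  rcases mul_eq_zero.1 H with h | h
  · exact ⟨hp', (expand_eq_zero zero_lt_two).1 h⟩
  · exact absurd h (X_ne_zero _)

/-- Normal form modulo `J = (U₀² − x₁, U₁² − x₁ⁿ x₂)` in `k[x₁, x₂, U₀, U₁]` (`x_j = X (inl j)`,
`U_i = X (inr i)`): every polynomial is congruent to `r₀(x₂, U₀) + r₁(x₂, U₀) · U₁`, the
polynomials `r₀, r₁ ∈ k[X 0, X 1]` being embedded by `X 0 ↦ x₂`, `X 1 ↦ U₀`. [folklore] -/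
theorem exists_normalForm_bicyclic {k : Type*} [Field k] (n : ℕ)
    (f : MvPolynomial (Fin 2 ⊕ Fin 2) k) :
    ∃ r₀ r₁ : MvPolynomial (Fin 2) k,
      f - (rename ![Sum.inl 1, Sum.inr 0] r₀ + rename ![Sum.inl 1, Sum.inr 0] r₁ * X (Sum.inr 1)) ∈
        Ideal.span {(X (Sum.inr 0) ^ 2 - X (Sum.inl 0) : MvPolynomial (Fin 2 ⊕ Fin 2) k),
          X (Sum.inr 1) ^ 2 - X (Sum.inl 0) ^ n * X (Sum.inl 1)} := by
  set J : Ideal (MvPolynomial (Fin 2 ⊕ Fin 2) k) :=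
    Ideal.span {(X (Sum.inr 0) ^ 2 - X (Sum.inl 0) : MvPolynomial (Fin 2 ⊕ Fin 2) k),
      X (Sum.inr 1) ^ 2 - X (Sum.inl 0) ^ n * X (Sum.inl 1)} with hJ
  set e : Fin 2 → Fin 2 ⊕ Fin 2 := ![Sum.inl 1, Sum.inr 0] with he
  have he0 : rename e (X 0 : MvPolynomial (Fin 2) k) = X (Sum.inl 1) := by simp [he]
  have he1 : rename e (X 1 : MvPolynomial (Fin 2) k) = X (Sum.inr 0) := by simp [he]
  have hB0 : (X (Sum.inr 0) ^ 2 - X (Sum.inl 0) : MvPolynomial (Fin 2 ⊕ Fin 2) k) ∈ J :=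
    Ideal.subset_span (Set.mem_insert _ _)
  have hB1 : (X (Sum.inr 1) ^ 2 - X (Sum.inl 0) ^ n * X (Sum.inl 1) :
      MvPolynomial (Fin 2 ⊕ Fin 2) k) ∈ J :=
    Ideal.subset_span (Set.mem_insert_of_mem _ (Set.mem_singleton _))
  have hpow :
      (X (Sum.inl 0) ^ n - (X (Sum.inr 0) ^ 2) ^ n : MvPolynomial (Fin 2 ⊕ Fin 2) k) ∈ J := by
    obtain ⟨c, hc⟩ := sub_dvd_pow_sub_pow (X (Sum.inl 0) : MvPolynomial (Fin 2 ⊕ Fin 2) k)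
      (X (Sum.inr 0) ^ 2) n
    rw [hc]
    refine J.mul_mem_right c ?_
    rw [← neg_sub]
    exact J.neg_mem_iff.mpr hB0
  induction f using MvPolynomial.induction_on with
  | C a => exact ⟨C a, 0, by simp⟩
  | add f g hf hg =>
    obtain ⟨r₀, r₁, hr⟩ := hf
    obtain ⟨s₀, s₁, hs⟩ := hg
    refine ⟨r₀ + s₀, r₁ + s₁, ?_⟩
    convert J.add_mem hr hs using 1
    simp only [map_add]
    ring
  | mul_X f i hf =>
    obtain ⟨r₀, r₁, hr⟩ := hf
    revert i
    rw [Sum.forall, Fin.forall_fin_two, Fin.forall_fin_two]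
    refine ⟨⟨?_, ?_⟩, ?_, ?_⟩
    · -- multiplication by `x₁ ≡ U₀²`
      refine ⟨r₀ * X 1 ^ 2, r₁ * X 1 ^ 2, ?_⟩
      convert J.sub_mem (J.mul_mem_right (X (Sum.inl 0)) hr)
        (J.mul_mem_left (rename e r₀ + rename e r₁ * X (Sum.inr 1)) hB0) using 1
      simp only [map_mul, map_pow, he1]
      ring
    · -- multiplication by `x₂`
      refine ⟨r₀ * X 0, r₁ * X 0, ?_⟩
      convert J.mul_mem_right (X (Sum.inl 1)) hr using 1
      simp only [map_mul, he0]
      ring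
    · -- multiplication by `U₀`
      refine ⟨r₀ * X 1, r₁ * X 1, ?_⟩
      convert J.mul_mem_right (X (Sum.inr 0)) hr using 1
      simp only [map_mul, he1]
      ring
    · -- multiplication by `U₁`: `U₁² ≡ x₁ⁿ x₂ ≡ U₀²ⁿ x₂`
      refine ⟨r₁ * X 1 ^ (2 * n) * X 0, r₀, ?_⟩
      convert J.add_mem (J.add_mem (J.mul_mem_right (X (Sum.inr 1)) hr)
        (J.mul_mem_left (rename e r₁) hB1))
        (J.mul_mem_left (rename e r₁ * X (Sum.inl 1)) hpow) using 1
      simp only [map_mul, map_pow, he0, he1]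
      ring

/-- The binomial ideal `J = (U₀² − x₁, U₁² − x₁ⁿ x₂) ⊂ k[x₁, x₂, U₀, U₁]` is prime in every
characteristic: it is the kernel of the `k`-algebra map `x₁ ↦ s⁴, x₂ ↦ w², U₀ ↦ s², U₁ ↦ s²ⁿ w`
into the domain `k[w, s]` (`w = X 0`, `s = X 1`). [folklore] -/
theorem isPrime_span_bicyclic {k : Type*} [Field k] (n : ℕ) :
    (Ideal.span {(X (Sum.inr 0) ^ 2 - X (Sum.inl 0) : MvPolynomial (Fin 2 ⊕ Fin 2) k),
      X (Sum.inr 1) ^ 2 - X (Sum.inl 0) ^ n * X (Sum.inl 1)}).IsPrime := by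
  classical
  set J : Ideal (MvPolynomial (Fin 2 ⊕ Fin 2) k) :=
    Ideal.span {(X (Sum.inr 0) ^ 2 - X (Sum.inl 0) : MvPolynomial (Fin 2 ⊕ Fin 2) k),
      X (Sum.inr 1) ^ 2 - X (Sum.inl 0) ^ n * X (Sum.inl 1)} with hJ
  -- the test map into the domain `k[w, s]`
  set φ : MvPolynomial (Fin 2 ⊕ Fin 2) k →ₐ[k] MvPolynomial (Fin 2) k :=
    aeval (Sum.elim ![X 1 ^ 4, X 0 ^ 2] ![X 1 ^ 2, X 1 ^ (2 * n) * X 0]) with hφ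
  have hφ1 : φ (X (Sum.inl 0)) = X 1 ^ 4 := by simp [hφ]
  have hφ2 : φ (X (Sum.inl 1)) = X 0 ^ 2 := by simp [hφ]
  have hφ3 : φ (X (Sum.inr 0)) = X 1 ^ 2 := by simp [hφ]
  have hφ4 : φ (X (Sum.inr 1)) = X 1 ^ (2 * n) * X 0 := by simp [hφ]
  have hcomp : φ.comp (rename ![Sum.inl 1, Sum.inr 0]) = expand 2 :=
    algHom_ext (Fin.forall_fin_two.mpr ⟨by simp [hφ], by simp [hφ]⟩)
  have hφe : ∀ r : MvPolynomial (Fin 2) k, φ (rename ![Sum.inl 1, Sum.inr 0] r) = expand 2 r :=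
    fun r => DFunLike.congr_fun hcomp r
  have hle : J ≤ RingHom.ker φ := by
    rw [hJ, Ideal.span_le]
    rintro x (rfl | rfl)
    · rw [SetLike.mem_coe, RingHom.mem_ker, map_sub, map_pow, hφ1, hφ3]
      ring
    · rw [SetLike.mem_coe, RingHom.mem_ker, map_sub, map_mul, map_pow, map_pow, hφ4, hφ1, hφ2]
      ring
  suffices hker : RingHom.ker φ = J by rw [← hker]; exact RingHom.ker_isPrime φ
  refine le_antisymm (fun f hf => ?_) hle
  rw [RingHom.mem_ker] at hf
  obtain ⟨r₀, r₁, hr⟩ := exists_normalForm_bicyclic n f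
  have himg : expand 2 r₀ + expand 2 (r₁ * X 1 ^ n) * X 0 = 0 := by
    have h0 := hle hr
    rw [RingHom.mem_ker, map_sub, hf, zero_sub, neg_eq_zero, map_add, map_mul, hφe, hφe,
      hφ4] at h0
    have h1 : expand 2 (r₁ * X 1 ^ n) = expand 2 r₁ * X 1 ^ (2 * n) := by
      rw [map_mul, map_pow, expand_X, ← pow_mul]
    rw [h1, mul_assoc]
    exact h0
  obtain ⟨hr₀, hr₁⟩ := eq_zero_of_expand_two_add himg
  have hr₁' : r₁ = 0 := (mul_eq_zero.1 hr₁).resolve_right (pow_ne_zero _ (X_ne_zero _))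
  simpa [hr₀, hr₁'] using hr

/-! ## The datum -/

/-- `Set.range` of a family indexed by `Fin 2`. [folklore] -/
private theorem range_fin_two {α : Type*} (f : Fin 2 → α) : Set.range f = {f 0, f 1} := by
  ext x
  simp only [Set.mem_range, Fin.exists_fin_two, Set.mem_insert_iff, Set.mem_singleton_iff]
  constructor <;> rintro (rfl | rfl) <;> simp

/-- The weight inequality `2 v₀ = (1, 0) < (n/2, 1/2) = v₁` (product order) for `n ≥ 2`.
[folklore] -/
private theorem two_smul_weight_lt (n : ℕ) (hn : 2 ≤ n) :
    2 • (![1 / 2, 0] : Fin 2 → ℚ) ≤ ![(n : ℚ) / 2, 1 / 2] ∧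
      2 • (![1 / 2, 0] : Fin 2 → ℚ) ≠ ![(n : ℚ) / 2, 1 / 2] := by
  have hn' : (2 : ℚ) ≤ n := by exact_mod_cast hn
  refine ⟨fun j => ?_, fun h => ?_⟩
  · revert j
    rw [Fin.forall_fin_two]
    refine ⟨?_, ?_⟩
    · simp only [Pi.smul_apply, Matrix.cons_val_zero, nsmul_eq_mul]
      linarith
    · simp
  · have := congr_fun h 1
    simp only [Pi.smul_apply, Matrix.cons_val_one, Matrix.cons_val_zero, nsmul_eq_mul] at this
    norm_num at this

/-- The binomial ideal of the datum is `(U₀² − x₁, U₁² − x₁ⁿ x₂)`. [folklore] -/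
theorem binomialIdeal_bicyclic_eq {k : Type} [Field k] (n : ℕ) :
    Teissier.binomialIdeal (k := k) (d := 2) (g := 2) (fun _ => 2) (fun _ => (1 : k))
        ![Finsupp.single 0 1, Finsupp.single 0 n + Finsupp.single 1 1] (fun _ => 0) =
      Ideal.span {(X (Sum.inr 0) ^ 2 - X (Sum.inl 0) : MvPolynomial (Fin 2 ⊕ Fin 2) k),
        X (Sum.inr 1) ^ 2 - X (Sum.inl 0) ^ n * X (Sum.inl 1)} := by
  have hA : (Finsupp.single 0 n + Finsupp.single 1 1 : Fin 2 →₀ ℕ).sumElim (0 : Fin 2 →₀ ℕ) =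
      Finsupp.single (Sum.inl 0) n + Finsupp.single (Sum.inl 1) 1 := by
    ext x
    rcases x with b | b <;> simp [Finsupp.sumElim_apply, Finsupp.single_apply]
  have hm : (monomial (Finsupp.single (Sum.inl 0) n + Finsupp.single (Sum.inl 1) 1) 1 :
      MvPolynomial (Fin 2 ⊕ Fin 2) k) = X (Sum.inl 0) ^ n * X (Sum.inl 1) := by
    rw [X_pow_eq_monomial, ← pow_one (X (Sum.inl 1)), X_pow_eq_monomial, monomial_mul, one_mul]
  have h0 : Teissier.binomial (k := k) (d := 2) (g := 2) (fun _ => 2) (fun _ => (1 : k))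
      ![Finsupp.single 0 1, Finsupp.single 0 n + Finsupp.single 1 1] (fun _ => 0) 0 =
      X (Sum.inr 0) ^ 2 - X (Sum.inl 0) := by
    simp only [Teissier.binomial, Matrix.cons_val_zero, Finsupp.sumElim_single_zero, map_one,
      one_mul]
    rw [← X_pow_eq_monomial, pow_one]
  have h1 : Teissier.binomial (k := k) (d := 2) (g := 2) (fun _ => 2) (fun _ => (1 : k))
      ![Finsupp.single 0 1, Finsupp.single 0 n + Finsupp.single 1 1] (fun _ => 0) 1 =
      X (Sum.inr 1) ^ 2 - X (Sum.inl 0) ^ n * X (Sum.inl 1) := by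
    simp only [Teissier.binomial, Matrix.cons_val_one, Matrix.cons_val_zero, map_one, one_mul]
    rw [hA, hm]
  unfold Teissier.binomialIdeal
  rw [range_fin_two, h0, h1]

/-- The Teissier datum of the over-blown bicyclic fibre product: `n = (2, 2)`, `v₀ = (1/2, 0)`,
`v₁ = (n/2, 1/2)`, `c = 1`, `A₀ = (1, 0)`, `A₁ = (n, 1)`, `μ = 0`, `h₀ = u₁`, `h₁ = 0`.
[folklore] -/
theorem isDatum_bicyclic {k : Type} [Field k] (n : ℕ) (hn : 2 ≤ n) :
    Teissier.IsDatum (k := k) (d := 2) (g := 2) (fun _ => 2)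
      ![![1 / 2, 0], ![(n : ℚ) / 2, 1 / 2]] (fun _ => 1)
      ![Finsupp.single 0 1, Finsupp.single 0 n + Finsupp.single 1 1] (fun _ => 0)
      ![MvPolynomial.X 1, 0] where
  two_le _ := le_rfl
  coeff_ne_zero _ := one_ne_zero
  weight_nonneg i j := by
    fin_cases i <;> fin_cases j <;> simp
    positivity
  mu_eq_zero _ _ _ := rfl
  homogeneous := Fin.forall_fin_two.mpr ⟨by
      funext j
      fin_cases j <;> simp [Teissier.weight_apply], by
      funext j
      fin_cases j
      · simp [Teissier.weight_apply]
        ring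
      · simp [Teissier.weight_apply]⟩
  weight_lt := Fin.forall_fin_two.mpr ⟨fun hi => by
      have h1 : (⟨(0 : Fin 2).val + 1, hi⟩ : Fin 2) = 1 := rfl
      rw [h1]
      exact two_smul_weight_lt n hn, fun hi => absurd hi (by decide)⟩
  overweight := by
    classical
    refine Fin.forall_fin_two.mpr ⟨fun e he => ?_, fun e he => by simp at he⟩
    have he' : e = Finsupp.single 1 1 := by simpa [MvPolynomial.support_X] using he
    subst he'
    refine ⟨Fin.forall_fin_two.mpr
        ⟨fun hj => absurd hj (by decide), fun hj => absurd hj (by decide)⟩, fun a ha => ?_⟩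
    have ha0 : a = 0 := by
      by_contra hne
      apply ha
      simp [MvPowerSeries.coeff_one, hne]
    subst ha0
    have hw : Teissier.weight (![![(1 : ℚ) / 2, 0], ![(n : ℚ) / 2, 1 / 2]] : Fin 2 → Fin 2 → ℚ) 0
        (Finsupp.single 1 1) = ![(n : ℚ) / 2, 1 / 2] := by
      funext j
      rw [Teissier.weight_apply, Fin.sum_univ_two]
      fin_cases j <;> simp
    rw [hw]
    exact two_smul_weight_lt n hn
  isPrime := by
    rw [binomialIdeal_bicyclic_eq]
    exact isPrime_span_bicyclic n

/-- The presentation ideal of the datum is `(−(u₀² − x₁), u₁² − x₁ⁿ x₂) = (u₀² − x₁, u₁² − x₁ⁿ x₂)`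
in `Λ[u₀, u₁]`, `Λ = k⟦x₁, x₂⟧`. [folklore] -/
theorem ideal_bicyclic_eq {k : Type} [Field k] (n : ℕ) :
    Teissier.ideal (k := k) (d := 2) (g := 2) (fun _ => 2) (fun _ => 1)
        ![Finsupp.single 0 1, Finsupp.single 0 n + Finsupp.single 1 1] (fun _ => 0)
        ![MvPolynomial.X 1, 0] =
      Ideal.span {(MvPolynomial.X 0 ^ 2 - MvPolynomial.C (MvPowerSeries.X 0) :
          MvPolynomial (Fin 2) (MvPowerSeries (Fin 2) k)),
        MvPolynomial.X 1 ^ 2 - MvPolynomial.C (MvPowerSeries.X 0 ^ n * MvPowerSeries.X 1)} := by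
  have hm : (MvPowerSeries.X 0 ^ n * MvPowerSeries.X 1 : MvPowerSeries (Fin 2) k) =
      MvPowerSeries.monomial (Finsupp.single 0 n + Finsupp.single 1 1) 1 := by
    rw [MvPowerSeries.X_pow_eq, MvPowerSeries.X_def, MvPowerSeries.monomial_mul_monomial, mul_one]
  have h0 : Teissier.equation (k := k) (d := 2) (g := 2) (fun _ => 2) (fun _ => 1)
      ![Finsupp.single 0 1, Finsupp.single 0 n + Finsupp.single 1 1] (fun _ => 0)
      ![MvPolynomial.X 1, 0] 0 = -(MvPolynomial.X 0 ^ 2 - MvPolynomial.C (MvPowerSeries.X 0)) := by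
    have h01 : (0 : Fin 2).val + 1 < 2 := by decide
    have h1 : (⟨(0 : Fin 2).val + 1, h01⟩ : Fin 2) = 1 := rfl
    rw [Teissier.equation, dif_pos h01, h1, Teissier.core]
    simp only [Matrix.cons_val_zero, ← MvPowerSeries.X_def, monomial_zero', C_1, mul_one]
    ring
  have h1 : Teissier.equation (k := k) (d := 2) (g := 2) (fun _ => 2) (fun _ => 1)
      ![Finsupp.single 0 1, Finsupp.single 0 n + Finsupp.single 1 1] (fun _ => 0)
      ![MvPolynomial.X 1, 0] 1 =
      MvPolynomial.X 1 ^ 2 - MvPolynomial.C (MvPowerSeries.X 0 ^ n * MvPowerSeries.X 1) := by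
    have h11 : ¬ ((1 : Fin 2).val + 1 < 2) := by decide
    rw [Teissier.equation, dif_neg h11, Teissier.core, hm]
    simp only [Matrix.cons_val_one, Matrix.cons_val_zero, monomial_zero', C_1, mul_one, add_zero]
  unfold Teissier.ideal
  rw [range_fin_two, h0, h1, Ideal.span_insert, Ideal.span_singleton_neg, ← Ideal.span_insert]

/-- STUB `stub_bicyclicOverblown` (barrier note BN1, positive half). After over-blowing the base
(`x₂ ↦ x₁ⁿ x₂`, `n ≥ 2`) the NON-normalised fibre product `Λ[y₁,y₂]/(y₁² − x₁, y₂² − x₁ⁿ x₂)` IS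
Teissier-presented, in the loose form (`E₀ = −(u₀² − x₁)` via `h₀ := u₁`, `E₁ = u₁² − x₁ⁿx₂`;
weights `v₀ = (1/2,0) < (1,0) = 2v₀ ≤ v₁ = (n/2,1/2)`; the binomial ideal `(u₀² − x₁, u₁² − x₁ⁿx₂)`
is prime in every characteristic). [folklore] -/
theorem stub_bicyclicOverblown {k : Type} [Field k] (n : ℕ) (hn : 2 ≤ n) :
    TeissierPresentation k 2
      (MvPolynomial (Fin 2) (MvPowerSeries (Fin 2) k) ⧸ Ideal.span
        ({MvPolynomial.X 0 ^ 2 - MvPolynomial.C (MvPowerSeries.X 0),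
          MvPolynomial.X 1 ^ 2 - MvPolynomial.C (MvPowerSeries.X 0 ^ n * MvPowerSeries.X 1)} :
          Set (MvPolynomial (Fin 2) (MvPowerSeries (Fin 2) k))))
      ((Ideal.Quotient.mk _).comp MvPolynomial.C) :=
  ⟨2, fun _ => 2, ![![1 / 2, 0], ![(n : ℚ) / 2, 1 / 2]], fun _ => 1,
    ![Finsupp.single 0 1, Finsupp.single 0 n + Finsupp.single 1 1], fun _ => 0,
    ![MvPolynomial.X 1, 0], isDatum_bicyclic n hn,
    Ideal.quotEquivOfEq (ideal_bicyclic_eq n).symm, fun a => by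
      rw [RingHom.comp_apply, Ideal.quotEquivOfEq_mk]⟩

end Summit.ResolutionOfSingularities.ResolutionOfSingularities.Theorems.TeissierReduction

end
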